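import Summits.HodgeConjecture.HodgeConjecture.Theorems.NikulinTwinTransportLefschetzOneOneK3Calculus
import Literature.Geometry.Kaehler.ConnectionExists
import Literature.Geometry.Kaehler.ManifoldFormsPullback
import Literature.Geometry.Kaehler.MayerVietoris
import Literature.NumberTheory.Transcendental.DeRhamTheorem
import Mathlib.Analysis.SpecialFunctions.Complex.LogDeriv

/-!
# Route NikulinTwinTransport — `LefschetzOneOneK3`, `∂∂̄`–exponential line: `∂∂̄ψ` is exact where the exponential cocycle is trivial

Let `(U_i)` be an open cover of the complex manifold `M`, `ψ_i` functions smooth on `U_i` whose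
`∂∂̄` glue to a smooth closed `2`-form `α` (`∂∂̄ψ_i = α` on `U_i`), and `G_ij` holomorphic on
`U_i ∩ U_j` with `∂ψ_i - ∂ψ_j = dG_ij` there. If the holomorphic cocycle `g_ij = exp(2πi G_ij)` is
trivialised over an open set `W` by non-vanishing holomorphic `s_i` (`s_j = g_ij s_i` on
`U_i ∩ U_j ∩ W`), then `α|_W` is exact on the open submanifold `W`
(`map_mk_eq_zero_of_isTrivialOn`): the `1`-forms `τ_i = -∂ψ_i - (2πi)⁻¹ s_i⁻¹ ds_i` agree on the
overlaps (`s_j⁻¹ ds_j = s_i⁻¹ ds_i + 2πi dG_ij`) and glue to `τ` with `dτ = ∂∂̄ψ_i + 0 = α` on `W`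
(`s⁻¹ ds` is closed: locally it is `d log(s/s(x))`). This is the step "`c₁(L)` vanishes where `L`
is trivial" of Voisin I, proof of Thm. 11.33, in the `∂∂̄`-potential presentation of the class.
Helper file for the reduction of the route item `LefschetzOneOneK3`.
-/

noncomputable section

open scoped Manifold ContDiff Topology ComplexConjugate
open Set Filter Complex
open Literature.Geometry.Kaehler
open Literature.NumberTheory.Transcendental

namespace Summit.HodgeConjecture.HodgeConjecture.Theorems

/-! ### Chart calculus of `0`-forms: products, `exp`, `log` -/

section ChartCalculus

variable {E : Type} [NormedAddCommGroup E] [NormedSpace ℂ E]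
  {M : Type} [TopologicalSpace M] [ChartedSpace E M] [IsManifold 𝓘(ℝ, E) ∞ M]

/-- `df x v = D (v 0)` when the chart reading of `f` at `x` has derivative `D` at the centre. [folklore] -/
theorem mextDeriv_ofFun_apply_of_hasFDerivAt {f : M → ℂ} {x : M} {D : E →L[ℝ] ℂ}
    (h : HasFDerivAt (f ∘ (extChartAt 𝓘(ℝ, E) x).symm) D (extChartAt 𝓘(ℝ, E) x x))
    (v : Fin 1 → TangentSpace 𝓘(ℝ, E) x) : mextDeriv (MForm.ofFun 𝓘(ℝ, E) f) x v = D (v 0) := by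
  rw [mextDeriv_ofFun_apply', h.fderiv]

omit [IsManifold 𝓘(ℝ, E) ∞ M] in
/-- The chart reading of `f` at `x`, evaluated at the centre, is `f x`. [folklore] -/
theorem comp_extChartAt_symm_apply (f : M → ℂ) (x : M) :
    (f ∘ (extChartAt 𝓘(ℝ, E) x).symm) (extChartAt 𝓘(ℝ, E) x x) = f x := by
  simp

/-- **Product rule for `0`-forms at a point**: `d(gf) = g df + f dg`. [folklore] -/
theorem mextDeriv_ofFun_mul {f g : M → ℂ} {x : M}
    (hf : DifferentiableAt ℝ (f ∘ (extChartAt 𝓘(ℝ, E) x).symm) (extChartAt 𝓘(ℝ, E) x x))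
    (hg : DifferentiableAt ℝ (g ∘ (extChartAt 𝓘(ℝ, E) x).symm) (extChartAt 𝓘(ℝ, E) x x)) :
    mextDeriv (MForm.ofFun 𝓘(ℝ, E) fun y ↦ g y * f y) x =
      g x • mextDeriv (MForm.ofFun 𝓘(ℝ, E) f) x + f x • mextDeriv (MForm.ofFun 𝓘(ℝ, E) g) x := by
  have h := hg.hasFDerivAt.mul hf.hasFDerivAt
  rw [comp_extChartAt_symm_apply, comp_extChartAt_symm_apply] at h
  ext v
  rw [mextDeriv_ofFun_apply_of_hasFDerivAt h v]
  simp [mextDeriv_ofFun_apply', smul_eq_mul]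

/-- **Chain rule for `exp` at a point**: `d e^{aG} = a e^{aG} dG`. [folklore] -/
theorem mextDeriv_ofFun_cexp {G : M → ℂ} {x : M} (a : ℂ)
    (hG : DifferentiableAt ℝ (G ∘ (extChartAt 𝓘(ℝ, E) x).symm) (extChartAt 𝓘(ℝ, E) x x)) :
    mextDeriv (MForm.ofFun 𝓘(ℝ, E) fun y ↦ exp (a * G y)) x =
      (a * exp (a * G x)) • mextDeriv (MForm.ofFun 𝓘(ℝ, E) G) x := by
  have h := (hG.hasFDerivAt.const_mul a).cexp
  rw [comp_extChartAt_symm_apply] at h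
  ext v
  rw [mextDeriv_ofFun_apply_of_hasFDerivAt h v]
  simp [mextDeriv_ofFun_apply', smul_eq_mul]
  ring

/-- **Chain rule for `log` at a point**: `d log h = h⁻¹ dh` where `h x` is in the slit plane.
[folklore] -/
theorem mextDeriv_ofFun_clog {h : M → ℂ} {x : M}
    (hh : DifferentiableAt ℝ (h ∘ (extChartAt 𝓘(ℝ, E) x).symm) (extChartAt 𝓘(ℝ, E) x x))
    (hx : h x ∈ slitPlane) :
    mextDeriv (MForm.ofFun 𝓘(ℝ, E) fun y ↦ log (h y)) x =
      (h x)⁻¹ • mextDeriv (MForm.ofFun 𝓘(ℝ, E) h) x := by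
  have hx' : (h ∘ (extChartAt 𝓘(ℝ, E) x).symm) (extChartAt 𝓘(ℝ, E) x x) ∈ slitPlane := by
    rwa [comp_extChartAt_symm_apply]
  have hd := (hasStrictFDerivAt_log_real hx').hasFDerivAt.comp _ hh.hasFDerivAt
  rw [comp_extChartAt_symm_apply] at hd
  ext v
  rw [mextDeriv_ofFun_apply_of_hasFDerivAt hd v]
  simp [mextDeriv_ofFun_apply', smul_eq_mul]

end ChartCalculus

/-! ### The logarithmic derivative `s⁻¹ ds` of a non-vanishing holomorphic function -/

section LogDeriv

variable {E : Type} [NormedAddCommGroup E] [NormedSpace ℂ E] [FiniteDimensional ℂ E]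
  {M : Type} [TopologicalSpace M] [ChartedSpace E M] [IsManifold 𝓘(ℂ, E) ω M]
  [IsManifold 𝓘(ℝ, E) ∞ M]

omit [FiniteDimensional ℂ E] [IsManifold 𝓘(ℂ, E) ω M] [IsManifold 𝓘(ℝ, E) ∞ M] in
/-- Real differentiability of the chart reading of a holomorphic function. [folklore] -/
theorem differentiableAt_real_of_hol {O : Set M} (hO : IsOpen O) {s : M → ℂ}
    (hs : MDifferentiableOn 𝓘(ℂ, E) 𝓘(ℂ, ℂ) s O) {x : M} (hx : x ∈ O) :
    DifferentiableAt ℝ (s ∘ (extChartAt 𝓘(ℝ, E) x).symm) (extChartAt 𝓘(ℝ, E) x x) :=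
  (differentiableAt_comp_extChartAt_symm_of_mdifferentiableAt
    ((hs x hx).mdifferentiableAt (hO.mem_nhds hx))).restrictScalars ℝ

/-- **`s⁻¹ ds` is locally `d log(s/s(x))`; hence it is smooth and closed.** For `s` holomorphic and
non-vanishing on an open `O` and `x ∈ O`: the `1`-form `y ↦ (s y)⁻¹ ds(y)` is smooth at `x` and its
exterior derivative vanishes at `x`. [cite: VoisinHodgeI2002, §3.3.1] -/
theorem logDeriv_smoothAt_and_closed {O : Set M} (hO : IsOpen O) {s : M → ℂ}
    (hs : MDifferentiableOn 𝓘(ℂ, E) 𝓘(ℂ, ℂ) s O) (hs0 : ∀ y ∈ O, s y ≠ 0) {x : M} (hx : x ∈ O) :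
    (MForm.cmul (fun y ↦ (s y)⁻¹) (mextDeriv (MForm.ofFun 𝓘(ℝ, E) s))).SmoothAt x ∧
      mextDeriv (MForm.cmul (fun y ↦ (s y)⁻¹) (mextDeriv (MForm.ofFun 𝓘(ℝ, E) s))) x = 0 := by
  -- the local logarithm `ℓ = log (s / s(x))` on the open neighbourhood `O' ⊆ O` of `x`
  set h : M → ℂ := fun y ↦ s y * (s x)⁻¹ with hh
  set O' : Set M := O ∩ h ⁻¹' slitPlane with hO'
  have hcont : ContinuousOn h O := (hs.continuousOn).mul continuousOn_const
  have hO'o : IsOpen O' := hcont.isOpen_inter_preimage hO isOpen_slitPlane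
  have hxO' : x ∈ O' := ⟨hx, by
    change s x * (s x)⁻¹ ∈ slitPlane
    rw [mul_inv_cancel₀ (hs0 x hx)]; exact one_mem_slitPlane⟩
  have hhol : MDifferentiableOn 𝓘(ℂ, E) 𝓘(ℂ, ℂ) h O := hs.mul mdifferentiableOn_const
  set ℓ : M → ℂ := fun y ↦ log (h y) with hℓ
  have hℓhol : MDifferentiableOn 𝓘(ℂ, E) 𝓘(ℂ, ℂ) ℓ O' := by
    intro y hy
    have h1 : MDifferentiableWithinAt 𝓘(ℂ, E) 𝓘(ℂ, ℂ) h O' y := (hhol y hy.1).mono inter_subset_left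
    have h2 : DifferentiableAt ℂ (fun t : ℂ ↦ log (id t)) (h y) := differentiableAt_id.clog hy.2
    exact h2.comp_mdifferentiableWithinAt h1
  have hℓs : ∀ y ∈ O', (MForm.ofFun 𝓘(ℝ, E) ℓ).SmoothAt y := fun y hy ↦ smoothAt_ofFun_of_hol hO'o hℓhol hy
  -- `dℓ = s⁻¹ ds` on `O'`
  have hdℓ : ∀ y ∈ O', mextDeriv (MForm.ofFun 𝓘(ℝ, E) ℓ) y =
      (MForm.cmul (fun y ↦ (s y)⁻¹) (mextDeriv (MForm.ofFun 𝓘(ℝ, E) s))) y := by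
    intro y hy
    rw [MForm.cmul_apply, hℓ, mextDeriv_ofFun_clog (differentiableAt_real_of_hol hO hhol hy.1) hy.2]
    have hsplit : (MForm.ofFun 𝓘(ℝ, E) h) = MForm.ofFun 𝓘(ℝ, E) fun y ↦ (s x)⁻¹ * s y := by
      funext z; ext v; simp [MForm.ofFun_apply, hh, mul_comm]
    rw [hsplit, ofFun_const_mul, mextDeriv_smul_complex_holds, Pi.smul_apply, smul_smul]
    congr 1
    change (s y * (s x)⁻¹)⁻¹ * (s x)⁻¹ = (s y)⁻¹
    field_simp [hs0 y hy.1, hs0 x hx]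
  have hev : ∀ᶠ y in 𝓝 x, mextDeriv (MForm.ofFun 𝓘(ℝ, E) ℓ) y =
      (MForm.cmul (fun y ↦ (s y)⁻¹) (mextDeriv (MForm.ofFun 𝓘(ℝ, E) s))) y := by
    filter_upwards [hO'o.mem_nhds hxO'] with y hy using hdℓ y hy
  have hℓev : ∀ᶠ y in 𝓝 x, (MForm.ofFun 𝓘(ℝ, E) ℓ).SmoothAt y := by
    filter_upwards [hO'o.mem_nhds hxO'] with y hy using hℓs y hy
  refine ⟨(MForm.SmoothAt.mextDeriv hℓev).congr_of_eventuallyEq hev, ?_⟩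
  rw [← mextDeriv_congr_of_eventuallyEq hev]
  exact mextDeriv_mextDeriv_of_smoothAt hℓev

omit [FiniteDimensional ℂ E] [IsManifold 𝓘(ℂ, E) ω M] in
/-- **Transformation of the logarithmic derivative under the exponential cocycle**: if
`t = e^{2πi G} s` on an open `O` with `G`, `s` holomorphic and `s` non-vanishing, then
`t⁻¹ dt = s⁻¹ ds + 2πi dG` at the points of `O`. [cite: VoisinHodgeI2002, §3.3.1] -/
theorem logDeriv_exp_mul {O : Set M} (hO : IsOpen O) {s t G : M → ℂ}
    (hs : MDifferentiableOn 𝓘(ℂ, E) 𝓘(ℂ, ℂ) s O) (hs0 : ∀ y ∈ O, s y ≠ 0)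
    (hG : MDifferentiableOn 𝓘(ℂ, E) 𝓘(ℂ, ℂ) G O)
    (hts : ∀ y ∈ O, t y = exp (2 * Real.pi * I * G y) * s y) {x : M} (hx : x ∈ O) :
    (MForm.cmul (fun y ↦ (t y)⁻¹) (mextDeriv (MForm.ofFun 𝓘(ℝ, E) t))) x =
      (MForm.cmul (fun y ↦ (s y)⁻¹) (mextDeriv (MForm.ofFun 𝓘(ℝ, E) s))) x +
        (2 * Real.pi * I) • mextDeriv (MForm.ofFun 𝓘(ℝ, E) G) x := by
  set g : M → ℂ := fun y ↦ exp (2 * Real.pi * I * G y) with hg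
  have hev : ∀ᶠ y in 𝓝 x, (MForm.ofFun 𝓘(ℝ, E) fun y ↦ g y * s y) y = MForm.ofFun 𝓘(ℝ, E) t y := by
    filter_upwards [hO.mem_nhds hx] with y hy
    ext v; simp [MForm.ofFun_apply, hts y hy, hg]
  have hGd := differentiableAt_real_of_hol hO hG hx
  have hsd := differentiableAt_real_of_hol hO hs hx
  have hgd : DifferentiableAt ℝ (g ∘ (extChartAt 𝓘(ℝ, E) x).symm) (extChartAt 𝓘(ℝ, E) x x) :=
    (hGd.hasFDerivAt.const_mul (2 * Real.pi * I)).cexp.differentiableAt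
  rw [MForm.cmul_apply, MForm.cmul_apply, ← mextDeriv_congr_of_eventuallyEq hev,
    mextDeriv_ofFun_mul hsd hgd, hg, mextDeriv_ofFun_cexp _ hGd, hts x hx, smul_add, smul_smul,
    smul_smul, smul_smul]
  have hgx : exp (2 * Real.pi * I * G x) ≠ 0 := exp_ne_zero _
  have hsx : s x ≠ 0 := hs0 x hx
  congr 1
  · congr 1; field_simp
  · congr 1; field_simp

end LogDeriv

/-! ### Gluing: `∂∂̄ψ` is exact where the cocycle is trivialised -/

section Glue

variable {E : Type} [NormedAddCommGroup E] [NormedSpace ℂ E] [FiniteDimensional ℂ E]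
  {M : Type} [TopologicalSpace M] [ChartedSpace E M] [IsManifold 𝓘(ℂ, E) ω M]
  [IsManifold 𝓘(ℝ, E) ∞ M] [T2Space M]

/-- **`∂∂̄ψ` is exact on the open submanifold over which the exponential cocycle is trivialised**
(module docstring). [cite: VoisinHodgeI2002, proof of Thm. 11.33 and §3.3.1] -/
theorem map_mk_eq_zero_of_isTrivialOn {ι : Type}
    (U : ι → Set M) (hU : ∀ i, IsOpen (U i)) (hcov : ∀ x, ∃ i, x ∈ U i)
    (ψ : ι → M → ℂ) (hψ : ∀ i, ∀ x ∈ U i, (MForm.ofFun 𝓘(ℝ, E) (ψ i)).SmoothAt x)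
    (G : ι → ι → M → ℂ) (hG : ∀ i j, MDifferentiableOn 𝓘(ℂ, E) 𝓘(ℂ, ℂ) (G i j) (U i ∩ U j))
    (hψG : ∀ i j, ∀ x ∈ U i ∩ U j,
      dolbeault (MForm.ofFun 𝓘(ℝ, E) (ψ i)) x - dolbeault (MForm.ofFun 𝓘(ℝ, E) (ψ j)) x =
        mextDeriv (MForm.ofFun 𝓘(ℝ, E) (G i j)) x)
    {α : MForm 𝓘(ℝ, E) M ℂ 2} (hs : IsSmoothForm α) (hc : IsClosedForm α)
    (hα : ∀ i, ∀ x ∈ U i, dolbeault (dolbeaultBar (MForm.ofFun 𝓘(ℝ, E) (ψ i))) x = α x)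
    (W : TopologicalSpace.Opens M) (s : ι → M → ℂ)
    (hs₁ : ∀ i, MDifferentiableOn 𝓘(ℂ, E) 𝓘(ℂ, ℂ) (s i) (U i ∩ W))
    (hs₂ : ∀ i, ∀ x ∈ U i ∩ W, s i x ≠ 0)
    (hs₃ : ∀ i j, ∀ x ∈ U i ∩ U j ∩ W, s j x = exp (2 * Real.pi * I * G i j x) * s i x) :
    complexDeRhamCohomology.map E (contMDiff_real_subtype_val (U := W)) 2
        (complexDeRhamCohomology.mk E M 2 ⟨α, mem_cclosedSmoothForms hs hc⟩) = 0 := by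
  choose idx hidx using hcov
  have hUW : ∀ i, IsOpen (U i ∩ (W : Set M)) := fun i ↦ (hU i).inter W.2
  -- the local `1`-forms `τ_i = -∂ψ_i - (2πi)⁻¹ s_i⁻¹ ds_i`
  set c₁ : ℂ := (2 * Real.pi * I)⁻¹ with hc₁
  have h2pi : (2 * Real.pi * I : ℂ) ≠ 0 := by
    simp [Real.pi_ne_zero, I_ne_zero]
  set lam : ι → MForm 𝓘(ℝ, E) M ℂ 1 := fun i ↦
    MForm.cmul (fun y ↦ (s i y)⁻¹) (mextDeriv (MForm.ofFun 𝓘(ℝ, E) (s i))) with hlam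
  set τ' : ι → MForm 𝓘(ℝ, E) M ℂ 1 := fun i ↦
    -dolbeault (MForm.ofFun 𝓘(ℝ, E) (ψ i)) + (-c₁) • lam i with hτ'
  have hlam_s : ∀ i, ∀ x ∈ U i ∩ (W : Set M), (lam i).SmoothAt x ∧ mextDeriv (lam i) x = 0 :=
    fun i x hx ↦ logDeriv_smoothAt_and_closed (hUW i) (hs₁ i) (hs₂ i) hx
  have hlam_tr : ∀ i j, ∀ x ∈ U i ∩ U j ∩ (W : Set M),
      lam j x = lam i x + (2 * Real.pi * I) • mextDeriv (MForm.ofFun 𝓘(ℝ, E) (G i j)) x := by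
    intro i j x hx
    have hO : IsOpen (U i ∩ U j ∩ (W : Set M)) := ((hU i).inter (hU j)).inter W.2
    exact logDeriv_exp_mul hO ((hs₁ i).mono fun y hy ↦ ⟨hy.1.1, hy.2⟩)
      (fun y hy ↦ hs₂ i y ⟨hy.1.1, hy.2⟩) ((hG i j).mono inter_subset_left)
      (fun y hy ↦ hs₃ i j y hy) hx
  have hτ'_s : ∀ i, ∀ x ∈ U i ∩ (W : Set M), (τ' i).SmoothAt x := fun i x hx ↦
    (mextDeriv_dolbeault_ofFun (hU i) (hψ i) hx.1).1.neg.add (smoothAt_smul_complex _ (hlam_s i x hx).1)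
  have hτ'_eq : ∀ i j, ∀ x ∈ U i ∩ U j ∩ (W : Set M), τ' i x = τ' j x := by
    intro i j x hx
    simp only [hτ', Pi.add_apply, Pi.neg_apply, Pi.smul_apply, hlam_tr i j x hx, smul_add, smul_smul,
      hc₁, inv_mul_cancel₀ h2pi, neg_smul, one_smul, ← hψG i j x hx.1]
    abel
  have hτ'_d : ∀ i, ∀ x ∈ U i ∩ (W : Set M), mextDeriv (τ' i) x = α x := by
    intro i x hx
    have h1 := mextDeriv_dolbeault_ofFun (hU i) (hψ i) hx.1
    change mextDeriv (-dolbeault (MForm.ofFun 𝓘(ℝ, E) (ψ i)) + (-c₁) • lam i) x = α x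
    rw [mextDeriv_add_apply h1.1.neg (smoothAt_smul_complex _ (hlam_s i x hx).1), mextDeriv_neg,
      Pi.neg_apply, h1.2, neg_neg, mextDeriv_smul_complex_holds, Pi.smul_apply, (hlam_s i x hx).2,
      smul_zero, add_zero, hα i x hx.1]
  -- the glued form `τ` on `M` (junk off `W`), smooth at the points of `W` with `dτ = α` there
  set τ : MForm 𝓘(ℝ, E) M ℂ 1 := fun x ↦ τ' (idx x) x with hτ
  have hτev : ∀ x ∈ (W : Set M), ∀ᶠ y in 𝓝 x, τ' (idx x) y = τ y := by
    intro x hx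
    filter_upwards [(hUW (idx x)).mem_nhds ⟨hidx x, hx⟩] with y hy
    exact hτ'_eq (idx x) (idx y) y ⟨⟨hy.1, hidx y⟩, hy.2⟩
  have hτs : ∀ x ∈ (W : Set M), τ.SmoothAt x := fun x hx ↦
    (hτ'_s (idx x) x ⟨hidx x, hx⟩).congr_of_eventuallyEq (hτev x hx)
  have hτd : ∀ x ∈ (W : Set M), mextDeriv τ x = α x := fun x hx ↦ by
    rw [← mextDeriv_congr_of_eventuallyEq (hτev x hx), hτ'_d (idx x) x ⟨hidx x, hx⟩]
  -- descent to the open submanifold `W`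
  have hβs : IsSmoothForm (τ.pullback 𝓘(ℝ, E) (Subtype.val : W → M)) :=
    fun x ↦ (hτs x x.2).pullback_subtypeVal
  have hdβ : mextDeriv (τ.pullback 𝓘(ℝ, E) (Subtype.val : W → M)) =
      α.pullback 𝓘(ℝ, E) (Subtype.val : W → M) := by
    funext x; ext v
    rw [mextDeriv_pullback_subtypeVal_apply (hτs x x.2), MForm.pullback_subtypeVal_apply, hτd x x.2]
  rw [complexDeRhamCohomology.map_mk, ← (complexDeRhamCohomology.mk E W 2).map_zero,
    complexDeRhamCohomology.mk_eq_mk_iff, Submodule.coe_zero, sub_zero]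
  change α.pullback 𝓘(ℝ, E) (Subtype.val : W → M) ∈ cexactSmoothForms E W 2
  rw [← hdβ]
  exact Submodule.subset_span ⟨_, (mem_csmoothForms_iff _).2 hβs, rfl⟩

end Glue

end Summit.HodgeConjecture.HodgeConjecture.Theorems

end
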